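import Summits.Ventures.Crystal3D.Theorems.StickyWulffConstantGenericWallFloorStarTransport
import Summits.Ventures.Crystal3D.Theorems.StickyWulffConstantGenericWallFloorTrichotomy
import HarnessLib

/-!
# Every capper owns a closed vertex star in the twin frame, hence is certified by the C12-55 row:
# the capper trichotomy = one step of stack propagation (crux `GenericWallFloor`, line `WallLedgerG`)

HONEST FRAMING. Part of the venture `Summits/Ventures/Crystal3D` (cell `crystal3d-full`), helper
`--supports` the crux `GenericWallFloor` (stmt-Ventures-19480), registered line `WallLedgerG`, open stub
`stub_twoSlabAdhesion`.  Sequel of `…TwinFrame` (the twin frame `A′` of a twin cap: every non-negative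
`A′`-slot of `e` is occupied, the cappers are the positive `A′`-slots) and `…StarTransport` (ONE `ExactOnly`
row for the closed vertex star serves every frame/centre/slot).  cf-p1 ROUTE §81(3): «each junk capper has
own ⊇ P₅ in the twin frame (wulff-p2), so trichotomy applies to it: unsaturated, interior in a local Barlow
stack, or twin-capped again» — here as theorems:

* **`capper_owns_closedStar`** — the capper `f = e + A′ w₀` has `f + A′ x ∈ X` for every slot `x` of the
  closed vertex star of `−w₀` (`⟪A′ x, A′ w₀⟫ < 0`): P₅ = C12-55;
* `exactOnly_capper_of_star_certificate` — hence its own part is exact-only from the C12-55 row;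
* **`capper_trichotomy`** — in a `1`-separated `X`: the capper has `≤ 11` contacts, OR all twelve
  `A′`-slots of `f` are occupied (the twin stack continues), OR `f` is an exact twin cap of the twin grain
  `A′` (normal `n′`, cappers of the capper) — `trichotomy_of_exactOnly` with the three independent slots of
  the hemisphere of `−w₀`.

WHAT THIS IS NOT: no global bound on stack heights / no count (the lane's N5); rung F-C1 not moved.
-/

noncomputable section

namespace Summit.Ventures.Crystal3D.Theorems

open Finset
open scoped InnerProductSpace

variable {X : Finset (EuclideanSpace ℝ (Fin 3))}

/-- **A capper owns the closed vertex star of `−w₀` in the twin frame.**  In the twin frame `A′` of a twin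
cap at `e` (normal `n`, menu `⟪A′ w, n⟫ ∈ {0, ±√(2/3)}`, every slot `e + A′ w` with `⟪A′ w, n⟫ ≥ 0` occupied —
the output of `twinFrame_of_twinCap`), the capper `f = e + A′ w₀` (`⟪A′ w₀, n⟫ > 0`) has `f + A′ x ∈ X`
for every slot `x` in the closed vertex star of `−w₀` (i.e. `⟪A′ x, A′ w₀⟫ < 0`): `x = −w₀` gives `e`, a
neighbour `x` of `−w₀` gives `e + A′(w₀ + x)` with `w₀ + x` a slot on the non-negative side of `n`.  This is
the pattern `P₅ = C12-55` again. -/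
theorem capper_owns_closedStar (A' : EuclideanSpace ℝ (Fin 3) ≃ₗᵢ[ℝ] EuclideanSpace ℝ (Fin 3))
    {n : EuclideanSpace ℝ (Fin 3)}
    (hmenu : ∀ w ∈ fccSlots, ⟪A' w, n⟫_ℝ = 0 ∨ ⟪A' w, n⟫_ℝ = Real.sqrt (2 / 3) ∨ ⟪A' w, n⟫_ℝ = -Real.sqrt (2 / 3))
    {e : EuclideanSpace ℝ (Fin 3)} (he : e ∈ X) (hocc : ∀ w ∈ fccSlots, 0 ≤ ⟪A' w, n⟫_ℝ → e + A' w ∈ X)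
    {w₀ : EuclideanSpace ℝ (Fin 3)} (hw₀ : w₀ ∈ fccSlots) (hpos : 0 < ⟪A' w₀, n⟫_ℝ)
    {x : EuclideanSpace ℝ (Fin 3)} (hx : x ∈ fccSlots) (hstar : ⟪A' x, A' w₀⟫_ℝ < 0) :
    e + A' w₀ + A' x ∈ X := by
  have hs : 0 < Real.sqrt (2 / 3) := Real.sqrt_pos.2 (by norm_num)
  have v₀ : ⟪A' w₀, n⟫_ℝ = Real.sqrt (2 / 3) := by
    rcases hmenu w₀ hw₀ with h | h | h
    · rw [h] at hpos; exact absurd hpos (lt_irrefl 0)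
    · exact h
    · rw [h] at hpos; linarith
  rw [LinearIsometryEquiv.inner_map_map] at hstar
  rcases inner_slots_mem hx hw₀ with h | h | h | h | h
  · linarith
  · linarith
  · linarith
  · -- a neighbour of `−w₀`: `w₀ + x` is a slot with `⟪A′(w₀ + x), n⟫ ≥ 0`
    have hsum : w₀ + x ∈ fccSlots :=
      add_mem_fccSlots_of_inner_eq_neg_half hw₀ hx (by rw [real_inner_comm]; exact h)
    have hnn : 0 ≤ ⟪A' (w₀ + x), n⟫_ℝ := by
      rw [map_add, inner_add_left, v₀]
      rcases hmenu x hx with h' | h' | h' <;> rw [h'] <;> linarith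
    have := hocc _ hsum hnn
    rw [map_add, ← add_assoc] at this
    exact this
  · -- `x = −w₀`: the star centre direction points back to `e`
    have hx' : x = -w₀ := eq_neg_of_inner_eq_neg_one hw₀ hx (by rw [real_inner_comm]; exact h)
    rw [hx', map_neg, add_neg_cancel_right]; exact he

/-- **Cappers are certified by the C12-55 row.**  Under the hypotheses of `capper_owns_closedStar`, the own
part `O` of the capper (any `O` containing its occupied slots) is exact-only, by `exactOnly_star_transport`
at the slot `−w₀` of the frame `A′`. -/
theorem exactOnly_capper_of_star_certificate
    {s₀ : EuclideanSpace ℝ (Fin 3)} (hs₀ : s₀ ∈ fccSlots)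
    (hcert : ExactOnly 0 (fccSlots.filter fun w => 0 < ⟪w, s₀⟫_ℝ))
    (A' : EuclideanSpace ℝ (Fin 3) ≃ₗᵢ[ℝ] EuclideanSpace ℝ (Fin 3)) {n : EuclideanSpace ℝ (Fin 3)}
    (hmenu : ∀ w ∈ fccSlots, ⟪A' w, n⟫_ℝ = 0 ∨ ⟪A' w, n⟫_ℝ = Real.sqrt (2 / 3) ∨ ⟪A' w, n⟫_ℝ = -Real.sqrt (2 / 3))
    {e : EuclideanSpace ℝ (Fin 3)} (he : e ∈ X) (hocc : ∀ w ∈ fccSlots, 0 ≤ ⟪A' w, n⟫_ℝ → e + A' w ∈ X)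
    {w₀ : EuclideanSpace ℝ (Fin 3)} (hw₀ : w₀ ∈ fccSlots) (hpos : 0 < ⟪A' w₀, n⟫_ℝ)
    {O : Finset (EuclideanSpace ℝ (Fin 3))} (hO : ∀ x ∈ fccSlots, e + A' w₀ + A' x ∈ X → e + A' w₀ + A' x ∈ O) :
    ExactOnly (e + A' w₀) O := by
  classical
  have hstar := exactOnly_star_transport hs₀ hcert A' (e + A' w₀) (neg_mem_fccSlots hw₀)
  refine hstar.mono ?_
  intro y hy
  obtain ⟨x, hx, rfl⟩ := Finset.mem_image.1 hy
  obtain ⟨hxS, hxpos⟩ := Finset.mem_filter.1 hx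
  have hlt : ⟪A' x, A' w₀⟫_ℝ < 0 := by
    rw [LinearIsometryEquiv.inner_map_map]; rw [inner_neg_right] at hxpos; linarith
  exact hO x hxS (capper_owns_closedStar A' hmenu he hocc hw₀ hpos hxS hlt)

/-- **The capper trichotomy.**  In a `1`-separated `X`, with the C12-55 row certified: a capper
`f = e + A′ w₀` of a twin cap (twin frame `A′`, data as above) has at most eleven contacts, OR all twelve
`A′`-slots of `f` are occupied (the twin stack continues through `f`), OR `f` is itself an exact twin cap
of the twin grain `A′` — stack propagation, one step. -/
theorem capper_trichotomy (hX : ∀ p ∈ X, ∀ q ∈ X, p ≠ q → 1 ≤ dist p q)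
    {s₀ : EuclideanSpace ℝ (Fin 3)} (hs₀ : s₀ ∈ fccSlots)
    (hcert : ExactOnly 0 (fccSlots.filter fun w => 0 < ⟪w, s₀⟫_ℝ))
    (A' : EuclideanSpace ℝ (Fin 3) ≃ₗᵢ[ℝ] EuclideanSpace ℝ (Fin 3)) {n : EuclideanSpace ℝ (Fin 3)}
    (hmenu : ∀ w ∈ fccSlots, ⟪A' w, n⟫_ℝ = 0 ∨ ⟪A' w, n⟫_ℝ = Real.sqrt (2 / 3) ∨ ⟪A' w, n⟫_ℝ = -Real.sqrt (2 / 3))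
    {e : EuclideanSpace ℝ (Fin 3)} (he : e ∈ X) (hocc : ∀ w ∈ fccSlots, 0 ≤ ⟪A' w, n⟫_ℝ → e + A' w ∈ X)
    {w₀ : EuclideanSpace ℝ (Fin 3)} (hw₀ : w₀ ∈ fccSlots) (hpos : 0 < ⟪A' w₀, n⟫_ℝ) :
    (X.filter fun q => dist (e + A' w₀) q = 1).card ≤ 11 ∨
    (∀ w ∈ fccSlots, e + A' w₀ + A' w ∈ X) ∨
    ∃ n' : EuclideanSpace ℝ (Fin 3), ‖n'‖ = 1 ∧
      (∀ w ∈ fccSlots, ⟪A' w, n'⟫_ℝ = 0 ∨ ⟪A' w, n'⟫_ℝ = Real.sqrt (2 / 3) ∨ ⟪A' w, n'⟫_ℝ = -Real.sqrt (2 / 3)) ∧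
      (∀ w ∈ fccSlots, ⟪A' w, n'⟫_ℝ ≤ 0 → e + A' w₀ + A' w ∈ X) ∧
      (∀ w ∈ fccSlots, 0 < ⟪A' w, n'⟫_ℝ →
        e + A' w₀ + A' w ∉ X ∧ e + A' w₀ - A' w + (2 * ⟪A' w, n'⟫_ℝ) • n' ∈ X) := by
  classical
  set f := e + A' w₀ with hf
  -- own part of `f`: its occupied slots that are contacts
  set O := X.filter fun q => dist f q = 1 ∧ ∃ x ∈ fccSlots, q = f + A' x with hO
  have hOsub : O ⊆ X.filter fun q => dist f q = 1 := by
    intro q hq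
    obtain ⟨hqX, hd, -⟩ := Finset.mem_filter.1 hq
    exact Finset.mem_filter.2 ⟨hqX, hd⟩
  have hOmem : ∀ x ∈ fccSlots, f + A' x ∈ X → f + A' x ∈ O := by
    intro x hx hxX
    refine Finset.mem_filter.2 ⟨hxX, ?_, x, hx, rfl⟩
    rw [dist_self_add_right, LinearIsometryEquiv.norm_map, norm_eq_one_of_mem_fccSlots hx]
  have hEO : ExactOnly f O := exactOnly_capper_of_star_certificate hs₀ hcert A' hmenu he hocc hw₀ hpos hOmem
  -- three independent occupied slots of `f`: the closed star of `−w₀` is a hemisphere pattern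
  have hν : A' w₀ ≠ 0 := by
    intro h
    have := norm_eq_one_of_mem_fccSlots hw₀
    rw [← A'.norm_map, h, norm_zero] at this; exact one_ne_zero this.symm
  obtain ⟨x₁, hx₁, x₂, hx₂, x₃, hx₃, h₁, h₂, h₃, hind⟩ := exists_independent_slots_of_hemisphere A' hν
  exact trichotomy_of_exactOnly hX A' hOsub hEO hx₁ hx₂ hx₃
    (capper_owns_closedStar A' hmenu he hocc hw₀ hpos hx₁ h₁)
    (capper_owns_closedStar A' hmenu he hocc hw₀ hpos hx₂ h₂)
    (capper_owns_closedStar A' hmenu he hocc hw₀ hpos hx₃ h₃) hind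

end Summit.Ventures.Crystal3D.Theorems

end
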